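import Summits.ResolutionOfSingularities.ResolutionOfSingularities.Theorems.FrobeniusClosingPatchingRelPerfectDepthMixedTargetsJ
import HarnessLib

/-!
# Chain W5.2 — «F5J» part 2: the PROVED compositions of the mixed engine with boundary (F5 v4)

[OURS · L1 W5.2] PROVED compositions over the statement-only module `…DepthMixedTargetsJ` (plan-1 gen 7, TargetsF5J part 1):
the forgetful map `IsWeightedSeqJ.isWeightedSeq`, the iteration `towerMixedJ_of_stepMixedJ`, the packaging `atomConclusion_of_pointwiseTwoMonomial`, and the
engine compositions `mixedEngineJ_of_targets`, `eside_of_weightTwoBoundaryJ₃`, `mixedEngineJTwo_threefold` (the `V = ⊤` constructor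
`gradedHostFormat_of_retraction` of the reused v3 format is the tree's, `…DepthMixedTargetsBCompositions` p511534).  Fact-free;
F-32bR enters only inside `WeightTwoBoundaryJ₃`.  NOT statements of the manuscript under review; AI-typed, weaker than expert review.
-/

-- `Summit.<Summit>.<Sub>.Theorems` with `Sub = Summit` (single-conjunct summit, D-0017)
set_option linter.dupNamespace false

noncomputable section

open CategoryTheory CategoryTheory.Limits AlgebraicGeometry TopologicalSpace
open Literature.AlgebraicGeometry.Resolution
open Scheme.IdealSheafData

namespace Summit.ResolutionOfSingularities.ResolutionOfSingularities.Theorems.DepthTargets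

universe u


/-- Forgetting the boundary: a weighted sequence with boundary is a weighted sequence (F2). [folklore] -/
theorem IsWeightedSeqJ.isWeightedSeq {μ : ℕ} :
    ∀ {E' E : Scheme.{u}} {ρ : E' ⟶ E} {𝔟 : E.IdealSheafData} {ℬ 𝒟 : List E.IdealSheafData}
      {𝔟' : E'.IdealSheafData} {ℬ' 𝒟' : List E'.IdealSheafData},
      IsWeightedSeqJ μ ρ 𝔟 ℬ 𝒟 𝔟' ℬ' 𝒟' → IsWeightedSeq μ ρ 𝔟 𝔟'
  | _, _, _, _, _, _, _, _, _, .nil 𝔟 ℬ 𝒟 => .nil 𝔟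
  | _, _, _, _, _, _, _, _, _, .cons τ ρ 𝔟 ℬ 𝒟 𝔟' ℬ' 𝒟' 𝔟'' C ν 𝒯 h hC h1 hν hle _ _ _ hτ heq _ =>
    .cons τ ρ 𝔟 𝔟' 𝔟'' C ν h.isWeightedSeq hC h1 hν hle hτ heq

/-- **Iterating formatted mixed steps WITH BOUNDARY along a weighted sequence with boundary** (p504758's
`towerMixed_of_stepMixed` with the boundary threaded): induction on `IsWeightedSeqJ`, the last ideal of each E-side step being
the controlled transform (`eq_controlledTransform_of_comap_eq_weighted`). [cite: BierstoneGrigorievMilmanWlodarczyk2011, §3.2 Lemma 3.2.1] -/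
theorem towerMixedJ_of_stepMixedJ {ℓ : ℕ}
    {P : ∀ ⦃E X : Scheme.{u}⦄, (E ⟶ X) → X.IdealSheafData → X.IdealSheafData →
      List E.IdealSheafData → List E.IdealSheafData → Prop}
    (hstep : StepMixedJ ℓ P) : TowerMixedJ ℓ P := by
  have key : ∀ {E' E : Scheme.{u}} {ρ : E' ⟶ E} {𝔟 : E.IdealSheafData} {ℬ 𝒟 : List E.IdealSheafData}
      {𝔟' : E'.IdealSheafData} {ℬ' 𝒟' : List E'.IdealSheafData},
      IsWeightedSeqJ ℓ ρ 𝔟 ℬ 𝒟 𝔟' ℬ' 𝒟' →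
      ∀ (S : Type u) [CommRing S] [IsRegularLocalRing S] (I : Ideal S) (X : Scheme.{u}) (i : E ⟶ X)
        (g : X ⟶ Spec (.of S)) (K N : X.IdealSheafData),
        DepthInvariantMono ℓ S I E X i g K N → P i K N ℬ 𝒟 → K.comap i = 𝔟 →
        ∃ (X' : Scheme.{u}) (π : X' ⟶ X) (i' : E' ⟶ X') (K' N' : X'.IdealSheafData),
          IsWeightedSeq ℓ π K K' ∧ i' ≫ π = ρ ≫ i ∧
          DepthInvariantMono ℓ S I E' X' i' (π ≫ g) K' N' ∧ K'.comap i' = 𝔟' ∧ P i' K' N' ℬ' 𝒟' := by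
    intro E' E ρ 𝔟 ℬ 𝒟 𝔟' ℬ' 𝒟' hseq
    induction hseq with
    | nil 𝔟 ℬ 𝒟 =>
      intro S _ _ I X i g K N hinv hP h𝔟
      exact ⟨X, 𝟙 X, i, K, N, .nil K, by simp, by simpa using hinv, h𝔟, hP⟩
    | cons τ ρ 𝔟 ℬ 𝒟 𝔟₁ ℬ₁ 𝒟₁ 𝔟₂ C ν 𝒯 hρ hC h1 hν hle hsnc hdef hmax hτ heq h𝒯 ih =>
      intro S _ _ I X i g K N hinv hP h𝔟
      obtain ⟨X₁, π, i₁, K₁, N₁, hXseq, hsq, hinv₁, hK₁, hP₁⟩ := ih S I X i g K N hinv hP h𝔟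
      have hle' : K₁.comap i₁ ≤ C ^ ν := hK₁ ▸ hle
      have hdef' : ∀ z : _, z ∈ C.support → (ν < ℓ ∨ ∃ B ∈ 𝒟₁, z ∈ B.support) →
          JointStepAt (K₁.comap i₁) C ℬ₁ 𝒟₁ z := by
        rw [hK₁]; exact hdef
      have hmax' : ν < ℓ → ∀ z : _, z ∈ C.support → ¬ stalkIdeal (K₁.comap i₁) z ≤ stalkIdeal C z ^ (ν + 1) := by
        rw [hK₁]; exact hmax
      obtain ⟨hperm, X₂, σ, i₂, hσ, hsq₂, hinv₂, hK₂, hP₂⟩ :=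
        hstep S I _ X₁ i₁ (π ≫ g) K₁ N₁ ℬ₁ 𝒟₁ hinv₁ hP₁ _ τ C ν 𝒯 hC h1 hν hle' hsnc hdef' hmax' hτ h𝒯
      haveI := hinv₁.isClosedImmersion
      refine ⟨X₂, σ ≫ π, i₂, controlledTransform σ (C.map i₁) K₁ ν,
        N₁.comap σ * (C.map i₁).comap σ ^ (ℓ - ν), ?_, ?_, ?_, ?_, hP₂⟩
      · refine .cons σ π K K₁ _ (C.map i₁) ν hXseq (DepthOne.isRegular_subscheme_map i₁ C hC) h1 hν hperm hσ ?_
        refine (hσ.pow_mul_controlledTransform_eq ?_).symm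
        have h : K₁.comap σ ≤ ((C.map i₁) ^ ν).comap σ :=
          Scheme.IdealSheafData.comap_mono (f := σ) hperm
        rwa [comap_pow] at h
      · rw [Category.assoc, ← hsq, ← Category.assoc, hsq₂, Category.assoc]
      · rw [Category.assoc]; exact hinv₂
      · rw [hK₂, hK₁]; exact (eq_controlledTransform_of_comap_eq_weighted hτ hle heq).symm
  intro S _ _ I E X i g K N ℬ 𝒟 hinv hP E' ρ 𝔟' ℬ' 𝒟' hseq
  exact key hseq S I X i g K N hinv hP rfl

/-- **PACKAGING (PROVED): a local two-monomial presentation of `K` at a state of the monomial-contact invariant gives the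
conclusion of the CORE**, given the local pair game: the cosupport of `K ⊇ N · 𝓘_E^ℓ` lies over the closed point
(`DepthOne.support_mul_ker_pow_over_closedPoint`, p505434) and contains that of `monomialIdeal A ⊔ monomialIdeal B`, the pair
game's centres compose with `g` to a blowing up cosupported in the closed point
(`MonomialCleanup.centreSeq_exists_isBlowup_comp_supported`, p504028; Stacks 080B), and `I𝒪 = M · M₀ · (A ⊔ B)` becomes
invertible on the regular top (`atomConclusion_of_tower`, D5). [cite: StacksProject, Tag 080A] -/
theorem atomConclusion_of_pointwiseTwoMonomial (hpair : PointwisePairGame.{u}) {ℓ : ℕ}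
    {S : Type u} [CommRing S] [IsRegularLocalRing S] {I : Ideal S} (hI : I ≠ ⊥)
    {E X : Scheme.{u}} {i : E ⟶ X} {g : X ⟶ Spec (.of S)} {K N : X.IdealSheafData}
    (hinv : DepthInvariantMono ℓ S I E X i g K N)
    {M₀ : X.IdealSheafData} {A B : List (X.IdealSheafData × ℕ)} (hM₀ : IsLocallyPrincipal M₀)
    (hAB : boundaryOf A = boundaryOf B)
    (hsnc : ∀ x : X, x ∈ (monomialIdeal A ⊔ monomialIdeal B).support → DepthSNC.SNCWithAt (boundaryOf A) ⊤ x)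
    (hK : K = M₀ * (monomialIdeal A ⊔ monomialIdeal B))
    (T : Scheme.{u}) (f : T ⟶ Spec (.of S)) (hf : IsBlowup f (affineBlowup.idealSheaf I)) :
    ∃ (J : T.IdealSheafData) (T' : Scheme.{u}) (π : T' ⟶ T), J ≠ ⊥ ∧
      (∀ t : T, t ∈ J.support → f.base t = IsLocalRing.closedPoint S) ∧
      IsBlowup π J ∧ Scheme.IsRegular T' := by
  haveI := hinv.isNoetherian
  haveI := hinv.isClosedImmersion
  obtain ⟨s, -, hover, htop, hlp⟩ := hpair X hinv.isRegular A B hAB hsnc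
  have hsupp : ((monomialIdeal A ⊔ monomialIdeal B).support : Set X) ⊆
      g ⁻¹' {IsLocalRing.closedPoint S} := by
    intro x hx
    have hxK : x ∈ (K.support : Set X) := by
      rw [hK, Scheme.IdealSheafData.support_mul, TopologicalSpace.Closeds.coe_sup]
      exact Or.inr hx
    have hx' : x ∈ ((N * i.ker ^ ℓ).support : Set X) := support_antitone hinv.mul_ker_pow_le hxK
    exact DepthOne.support_mul_ker_pow_over_closedPoint i g N ℓ hinv.mono_support hinv.map_eq_closedPoint x hx'
  obtain ⟨K₀, hg, hK₀⟩ := hinv.exists_isBlowup_supported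
  obtain ⟨Q, hQ, hQT⟩ := MonomialCleanup.centreSeq_exists_isBlowup_comp_supported s g
    {IsLocalRing.closedPoint S} ⟨K₀, hg, hK₀⟩ (CentreSeq.CentresOver.mono s hsupp hover)
  obtain ⟨M, hM, hfmt⟩ := hinv.exists_format
  refine atomConclusion_of_tower hI hQ hQT htop ?_ T f hf
  rw [Scheme.IdealSheafData.comap_comp, hfmt, hK, ← mul_assoc, comap_mul]
  exact ((hM.isLocallyPrincipal.mul hM₀).comap s.comp).mul hlp

/-- **PROVED COMPOSITION — the mixed engine from its four targets** (one boundary-carrying format `P`): initial format ⇒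
tower along the E-side sequence with boundary ⇒ local two-monomial presentation at the end ⇒ local pair game ⇒ D5. Fact-free.
[cite: Kollar2007, (3.111) Step 3] [cite: BierstoneGrigorievMilmanWlodarczyk2011, §3.2] -/
theorem mixedEngineJ_of_targets {ℓ : ℕ}
    (P : ∀ ⦃E X : Scheme.{u}⦄, (E ⟶ X) → X.IdealSheafData → X.IdealSheafData →
      List E.IdealSheafData → List E.IdealSheafData → Prop)
    (hinit : InitialB ℓ P) (htower : TowerMixedJ ℓ P) (hend : EndTwoMonomialJ ℓ P) (hpair : PointwisePairGame.{u}) :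
    MixedEngineJ.{u} ℓ := by
  intro S _ _ I hI E X i g K 𝓗 hinv hfmt hE T f hf
  obtain ⟨E', ρ, 𝔟', ℬ', 𝒟', hseq, hendE⟩ := hE
  have hinv₀ : DepthInvariantMono ℓ S I E X i g K ⊤ := DepthInvariantMono.of_depthInvariant hinv
  have hP₀ : P i K ⊤ ([] : List E.IdealSheafData) ([] : List E.IdealSheafData) := hinit S I E X i g K 𝓗 hinv hfmt
  obtain ⟨X', π, i', K', N', -, -, hinv', hK', hP'⟩ :=
    htower S I E X i g K ⊤ [] [] hinv₀ hP₀ E' ρ 𝔟' ℬ' 𝒟' hseq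
  obtain ⟨M₀, A, B, hM₀, hAB, hsnc, hK'eq⟩ :=
    hend S I E' X' i' (π ≫ g) K' N' ℬ' 𝒟' hinv' hP' (hK' ▸ hendE)
  exact atomConclusion_of_pointwiseTwoMonomial hpair hI hinv' hM₀ hAB hsnc hK'eq T f hf

/-- **The E-side datum of `MixedEngineJ 2` from T5-E** (projection): on an integral Noetherian regular excellent threefold, a
non-zero locally principal `K|_E` admits the required weighted sequence with boundary, mod F-32bR.
[cite: CossartJannsenSaito2020, Thm. 1.4] -/
theorem eside_of_weightTwoBoundaryJ₃ (hW : WeightTwoBoundaryJ₃.{u}) (hCJS : CossartJannsenSaito2020EmbeddedSequenceB.{u})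
    (E : Scheme.{u}) [IsIntegral E] [IsNoetherian E] (hreg : Scheme.IsRegular E) (hexc : Scheme.IsExcellent E)
    (hdim : topologicalKrullDim E = 3) (𝔟 : E.IdealSheafData) (h𝔟 : 𝔟 ≠ ⊥) (hlp : IsLocallyPrincipal 𝔟) :
    ∃ (E' : Scheme.{u}) (ρ : E' ⟶ E) (𝔟' : E'.IdealSheafData) (ℬ' 𝒟' : List E'.IdealSheafData),
      IsWeightedSeqJ 2 ρ 𝔟 [] [] 𝔟' ℬ' 𝒟' ∧ EndStateJ 𝔟' ℬ' := by
  obtain ⟨E', ρ, 𝔟', ℬ', 𝒟', hseq, -, -, -, hend⟩ := hW hCJS E hreg hexc hdim 𝔟 h𝔟 hlp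
  exact ⟨E', ρ, 𝔟', ℬ', 𝒟', hseq, hend⟩

/-- **The depth-two mixed engine on excellent regular threefolds, assembled** (PROVED composition): the format targets at
`ℓ = 2`, the local pair game and T5-E give the conclusion of the CORE at every initial graded-host state of depth two whose
exceptional scheme `E` is an integral Noetherian regular excellent threefold and whose E-side datum is non-zero and locally
principal — i.e. for every ONE-FORM state — modulo F-32bR (inside T5-E only).
[cite: Kollar2007, (3.111) Step 3] [cite: CossartJannsenSaito2020, Thm. 1.4] -/
theorem mixedEngineJTwo_threefold
    (P : ∀ ⦃E X : Scheme.{u}⦄, (E ⟶ X) → X.IdealSheafData → X.IdealSheafData →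
      List E.IdealSheafData → List E.IdealSheafData → Prop)
    (hinit : InitialB 2 P) (htower : TowerMixedJ 2 P) (hend : EndTwoMonomialJ 2 P) (hpair : PointwisePairGame.{u})
    (hW : WeightTwoBoundaryJ₃.{u}) (hCJS : CossartJannsenSaito2020EmbeddedSequenceB.{u})
    {S : Type u} [CommRing S] [IsRegularLocalRing S] {I : Ideal S} (hI : I ≠ ⊥)
    {E X : Scheme.{u}} [IsIntegral E] [IsNoetherian E] (hexc : Scheme.IsExcellent E) (hdim : topologicalKrullDim E = 3)
    {i : E ⟶ X} {g : X ⟶ Spec (.of S)} {K 𝓗 : X.IdealSheafData}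
    (hinv : DepthInvariant 2 S I E X i g K) (hfmt : GradedHostFormat 2 i K 𝓗)
    (hK : K.comap i ≠ ⊥) (hlp : IsLocallyPrincipal (K.comap i))
    (T : Scheme.{u}) (f : T ⟶ Spec (.of S)) (hf : IsBlowup f (affineBlowup.idealSheaf I)) :
    ∃ (J : T.IdealSheafData) (T' : Scheme.{u}) (π : T' ⟶ T), J ≠ ⊥ ∧
      (∀ t : T, t ∈ J.support → f.base t = IsLocalRing.closedPoint S) ∧
      IsBlowup π J ∧ Scheme.IsRegular T' :=
  mixedEngineJ_of_targets P hinit htower hend hpair S I hI E X i g K 𝓗 hinv hfmt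
    (eside_of_weightTwoBoundaryJ₃ hW hCJS E hinv.isRegular_exc hexc hdim (K.comap i) hK hlp) T f hf

end Summit.ResolutionOfSingularities.ResolutionOfSingularities.Theorems.DepthTargets

end
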